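import Literature.AnabelianGeometry.EtaleTheta.Discharge.Sec2MonodromyModelHatDottedClosures
import HarnessLib

/-!
# [EtTh] Prop. 2.6, profinite clause, at the monodromy model — part 4b: torsion and involutions in `A = cl(η Π^tp_{Ẋ̲})`, squares in
# `R`, and the coset descriptions `D = cl(η Π^tp_{Ċ̲̲}) = R ∪ R·ηι`, `B = cl(η Π^tp_{Ċ̲}) = A ∪ A·ηι` (proof-only)

S. Mochizuki, *The étale theta function and its Frobenioid-theoretic manifestations* [EtTh], Publ. RIMS **45** (2009), §2
Prop. 2.6, PDF p. 40, last sentence «A similar statement holds when "`Π^tp`" is replaced by "`Π`".»; Def. 2.5 (ii) p. 39; Rmk. 2.6.1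
p. 40 (`Aut_K` of the dotted members) [cite: MochizukiEtTh2009, Prop 2.6 p.40] [cite: MochizukiEtTh2009, Def 2.5(ii) p.39].
Cell abc-iut, block F, seat abc-iut-f-142 (gen 13), FACT-LIST row **F-0611** `TemperedCoverData.Prop26_profinite` — instance form at
abc-iut-w6-d084's monodromy model; sequel of parts 1–3 (`Sec2MonodromyModelHatRotationClosure`, `…HatScalings`, `…HatScalingsStabilise`).

WHAT IS PROVED (pure topological group theory about OUR carrier; sequel of part 4a `Sec2MonodromyModelHatDottedClosures.lean`, whose
torsion-freeness of `R` and description `A = η⟨z⟩ · R` are used BY NAME):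
* `exists_eq_zc_of_pow_l_eq_one` (the `l`-torsion of `A` is `η⟨z⟩`), `eq_one_of_sq_eq_one_A` (no involution in `A`, `l` odd),
  `zc_mul_rot_mul_iotaM_sq` (`(η z^c · x · η ι)² = η z^{2c}`), `exists_sq_or_t_mul_sq_of_mem_rot` (`R = R² ∪ η t · R²`: the squares form a
  compact, hence closed, subset containing the even powers of the loop);
* coset descriptions `mem_closure_dotCuu_iff` (`D = R ∪ R · η ι`), `mem_closure_dotCu_iff` (`B = A ∪ A · η ι`) — closures of finite unions
  of translates; `toHat_t_ne_one`, `iotaM_ne_one`.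
Sequel: parts 5–6 (the four extension theorems and `(monodromyModel l hl).Prop26_profinite`).

HONEST LABEL (abc-iut-L2-lead R1352, inherited from the carrier): «a DESIGNED tempered toy with print's monodromy combinatorics —
loop ↦ `Δ̄^ell` (`b`-cycle), the inversion INVERTS it, unipotent monodromy `x ↦ x·z` on the `a`-cycle, `z` = cusp inertia = `Δ̄_Θ`
central; `G_K := 1`; NOT a Tate curve, NOT the tempered fundamental group of a curve; consistency ≠ faithfulness.» PROOF-ONLY
companion (0 `def`, 0 `instance`, 0 notation, 0 `Prop`-definition; nothing of abc-iut-w6-d084's model files or of abc-iut-L2-t2's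
interface is edited or restated). Instance-at-OUR-carrier ≠ [EtTh] Prop. 2.6 for the profinite fundamental groups of a curve;
typed ≠ proved; no side is taken on [IUTchIII] Cor. 3.12 or on any author; nothing here asserts abc proved or refuted.
-/

noncomputable section

namespace Literature.AnabelianGeometry.EtaleTheta.ThetaCovers.MonodromyModel

open Multiplicative HeisenbergWitness TemperedModel DihedralGroup Topology
open Literature.AnabelianGeometry.SemiGraphs

variable (l : ℕ)

/-! ## 1–3. Torsion and involutions in `A`; squares in `R`; the closures `D` and `B` -/

section Structure

/-- `c^l = 1` in `ℤ/l` (multiplicative notation). (folklore; no claim about print) [cite: MochizukiEtTh2009, Rmk 2.6.1 p.40] -/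
theorem zmod_pow_card_eq_one (c : Multiplicative (ZMod l)) : c ^ l = 1 := by
  apply toAdd.injective
  rw [toAdd_pow, toAdd_one, nsmul_eq_mul, ZMod.natCast_self, zero_mul]

/-- `(z^c)^l = 1` in `TG l`. (toy bookkeeping; no claim about print) [cite: MochizukiEtTh2009, Rmk 2.6.1 p.40] -/
theorem zc_pow_card (c : Multiplicative (ZMod l)) : embCu l (c, 1) ^ l = 1 := by
  rw [← map_pow, Prod.pow_mk, one_pow, zmod_pow_card_eq_one, ← Prod.one_eq_mk, map_one]

/-- **`l`-torsion of `A` is `η⟨z⟩`.** (toy bookkeeping; no claim about print) [cite: MochizukiEtTh2009, Rmk 2.6.1 p.40] -/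
theorem exists_eq_zc_of_pow_l_eq_one [NeZero l] {R : Subgroup (PiC l)}
    (hR : R = ((Subgroup.zpowers (embCu l (1, r 1))).map (toHat l).toMonoidHom).topologicalClosure)
    (c : Multiplicative (ZMod l)) {x : PiC l} (hx : x ∈ R) (h : (toHat l (embCu l (c, 1)) * x) ^ l = 1) : x = 1 := by
  have hc : Commute (toHat l (embCu l (c, 1))) x := toHat_zc_comm l c x
  rw [hc.mul_pow, ← map_pow, zc_pow_card, map_one, one_mul] at h
  exact eq_one_of_pow_eq_one_of_mem_rot l hR hx (NeZero.ne l) h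

/-- **Order-`2` elements of `A` are trivial** (`l` odd). (toy bookkeeping; no claim about print) [cite: MochizukiEtTh2009, Rmk 2.6.1 p.40] -/
theorem eq_one_of_sq_eq_one_A [NeZero l] (hl : Odd l) {R : Subgroup (PiC l)}
    (hR : R = ((Subgroup.zpowers (embCu l (1, r 1))).map (toHat l).toMonoidHom).topologicalClosure)
    (c : Multiplicative (ZMod l)) {x : PiC l} (hx : x ∈ R) (h : (toHat l (embCu l (c, 1)) * x) ^ 2 = 1) :
    c = 1 ∧ x = 1 := by
  have hc : Commute (toHat l (embCu l (c, 1))) x := toHat_zc_comm l c x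
  have h2 : x ^ 2 = toHat l (embCu l ((c ^ 2)⁻¹, 1)) := by
    rw [hc.mul_pow, ← map_pow, ← map_pow, Prod.pow_mk, one_pow, ← eq_inv_mul_iff_mul_eq, mul_one,
      ← map_inv, ← map_inv, Prod.inv_mk, inv_one] at h
    exact h
  have h3 : x ^ (2 * l) = 1 := by
    rw [pow_mul, h2, ← map_pow, zc_pow_card, map_one]
  have hx1 : x = 1 := eq_one_of_pow_eq_one_of_mem_rot l hR hx (mul_ne_zero two_ne_zero (NeZero.ne l)) h3
  refine ⟨?_, hx1⟩
  rw [hx1, one_pow, eq_comm] at h2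
  have h4 : embCu l ((c ^ 2)⁻¹, 1) = 1 := toHat_injective l (by rw [h2, map_one])
  have h2u : IsUnit (2 : ZMod l) := by
    have := (ZMod.isUnit_iff_coprime 2 l).mpr (Nat.coprime_two_left.mpr hl)
    exact_mod_cast this
  have e : cC l (embCu l ((c ^ 2)⁻¹, 1)) = cC l (1 : TG l) := by rw [h4]
  rw [cC_embCu, toAdd_inv, toAdd_pow] at e
  change -(2 • toAdd c) = (0 : ZMod l) at e
  have e' : (2 : ZMod l) * toAdd c = 0 := by rw [nsmul_eq_mul, Nat.cast_ofNat] at e; linear_combination -e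
  exact toAdd_eq_zero.mp ((h2u.mul_right_eq_zero).mp e')

/-- `η(ι)⁻¹ = η(ι)`. (toy bookkeeping; no claim about print) [cite: MochizukiEtTh2009, Prop 2.2 p.37] -/
theorem iotaM_inv : (iotaM l)⁻¹ = iotaM l :=
  inv_eq_of_mul_eq_one_right (iotaM_mul_self l)

/-- **`(η z^c · x · η ι)² = η z^{2c}`** for `x ∈ R` (the reflections through `A = η⟨z⟩ · R` square into `η⟨z⟩`). (toy bookkeeping;
no claim about print) [cite: MochizukiEtTh2009, Prop 2.6 p.40] -/
theorem zc_mul_rot_mul_iotaM_sq [NeZero l] {R : Subgroup (PiC l)}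
    (hR : R = ((Subgroup.zpowers (embCu l (1, r 1))).map (toHat l).toMonoidHom).topologicalClosure)
    (c : Multiplicative (ZMod l)) {x : PiC l} (hx : x ∈ R) :
    (toHat l (embCu l (c, 1)) * x * iotaM l) ^ 2 = toHat l (embCu l (c ^ 2, 1)) := by
  have h1 : iotaM l * (toHat l (embCu l (c, 1)) * x) * (iotaM l)⁻¹ = toHat l (embCu l (c, 1)) * x⁻¹ := by
    rw [show iotaM l * (toHat l (embCu l (c, 1)) * x) * (iotaM l)⁻¹ =
        (iotaM l * toHat l (embCu l (c, 1)) * (iotaM l)⁻¹) * (iotaM l * x * (iotaM l)⁻¹) by group,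
      iotaM_conj_of_mem_rot l hR hx, ← toHat_zc_comm l c (iotaM l), mul_inv_cancel_right]
  rw [iotaM_inv] at h1
  rw [pow_two, show toHat l (embCu l (c, 1)) * x * iotaM l * (toHat l (embCu l (c, 1)) * x * iotaM l) =
      toHat l (embCu l (c, 1)) * x * (iotaM l * (toHat l (embCu l (c, 1)) * x) * iotaM l) by group, h1,
    show toHat l (embCu l (c, 1)) * x * (toHat l (embCu l (c, 1)) * x⁻¹) =
      toHat l (embCu l (c, 1)) * (x * toHat l (embCu l (c, 1))) * x⁻¹ by group, ← toHat_zc_comm l c x,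
    show toHat l (embCu l (c, 1)) * (toHat l (embCu l (c, 1)) * x) * x⁻¹ = toHat l (embCu l (c, 1)) * toHat l (embCu l (c, 1))
      by group, ← map_mul, ← map_mul, Prod.mk_mul_mk, mul_one, pow_two]

/-- **`R = R² ∪ η(t) · R²`**: every element of the rotation closure is a square or `η t` times a square (the squares form a compact,
hence closed, subset containing the even powers of the loop). (toy bookkeeping; no claim about print) [cite: MochizukiEtTh2009, §1 p.12] -/
theorem exists_sq_or_t_mul_sq_of_mem_rot {R : Subgroup (PiC l)}
    (hR : R = ((Subgroup.zpowers (embCu l (1, r 1))).map (toHat l).toMonoidHom).topologicalClosure)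
    {x : PiC l} (hx : x ∈ R) : ∃ w ∈ R, x = w ^ 2 ∨ x = toHat l (embCu l (1, r 1)) * w ^ 2 := by
  -- the set of squares of `R` is closed
  have hRc : IsCompact (R : Set (PiC l)) := by
    rw [hR]; exact (Subgroup.isClosed_topologicalClosure _).isCompact
  let Sq : Set (PiC l) := (fun w => w ^ 2) '' (R : Set (PiC l))
  have hSq : IsClosed Sq := (hRc.image (continuous_pow 2)).isClosed
  have hSq' : IsClosed ((Homeomorph.mulLeft (toHat l (embCu l (1, r 1)))) '' Sq) :=
    ((hRc.image (continuous_pow 2)).image (Homeomorph.mulLeft _).continuous).isClosed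
  subst hR
  have key := closed_subset_closure_eq_univ ((Subgroup.zpowers (embCu l (1, r 1))).map (toHat l).toMonoidHom)
    (P := Subtype.val ⁻¹' (Sq ∪ (Homeomorph.mulLeft (toHat l (embCu l (1, r 1)))) '' Sq))
    ((hSq.union hSq').preimage continuous_subtype_val) ?_ ⟨x, hx⟩
  · rcases key with ⟨w, hw, hwx⟩ | ⟨_, ⟨w, hw, rfl⟩, hwx⟩
    · exact ⟨w, hw, Or.inl hwx.symm⟩
    · exact ⟨w, hw, Or.inr hwx.symm⟩
  · intro y hy
    obtain ⟨k, rfl⟩ := (mem_map_zpowers_iff l).mp hy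
    obtain ⟨j, hj⟩ := Int.even_or_odd' k
    rcases hj with rfl | rfl
    · refine Or.inl ⟨toHat l (embCu l (1, r 1) ^ j), toHat_t_zpow_mem l rfl j, ?_⟩
      change toHat l (embCu l (1, r 1) ^ j) ^ 2 = toHat l (embCu l (1, r 1) ^ (2 * j))
      rw [← map_pow, ← zpow_natCast, ← zpow_mul, Nat.cast_ofNat, mul_comm]
    · refine Or.inr ⟨_, ⟨toHat l (embCu l (1, r 1) ^ j), toHat_t_zpow_mem l rfl j, rfl⟩, ?_⟩
      change toHat l (embCu l (1, r 1)) * toHat l (embCu l (1, r 1) ^ j) ^ 2 = toHat l (embCu l (1, r 1) ^ (2 * j + 1))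
      rw [← map_pow, ← map_mul, ← zpow_natCast, ← zpow_mul, Nat.cast_ofNat, ← zpow_one_add,
        show (1 : ℤ) + j * 2 = 2 * j + 1 by ring]

/-- `ι t^i = t^{-i} ι` in `TG l`. (toy bookkeeping; no claim about print) [cite: MochizukiEtTh2009, Rmk 2.1.1 p.36] -/
theorem iotaT_mul_t_zpow (i : ℤ) : iotaT l * embCu l (1, r 1) ^ i = (embCu l (1, r 1) ^ i)⁻¹ * iotaT l := by
  have h : iotaT l * embCu l (1, r 1) ^ i * (iotaT l)⁻¹ = (embCu l (1, r 1) ^ i)⁻¹ := by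
    rw [← MulAut.conj_apply, map_zpow, MulAut.conj_apply, iotaT_conj_t, inv_zpow]
  rw [← h, inv_mul_cancel_right]

/-- **Description of `D := cl(η Π^tp_{Ċ̲̲})`** (`Π^tp_{Ċ̲̲} = {b = c = 0, e = 1} ≅ D_∞`): `D = R ∪ R · η(ι)`. (toy bookkeeping for
[EtTh] Def. 2.5 (ii) / Rmk. 2.6.1; no claim about print) [cite: MochizukiEtTh2009, Def 2.5(ii) p.39] -/
theorem mem_closure_dotCuu_iff {R : Subgroup (PiC l)}
    (hR : R = ((Subgroup.zpowers (embCu l (1, r 1))).map (toHat l).toMonoidHom).topologicalClosure)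
    {D : Subgroup (PiC l)}
    (hD : D = (((heisD l).comap (PhiT l) ⊓ PiCdotT l).map (toHat l).toMonoidHom).topologicalClosure) (y : PiC l) :
    y ∈ D ↔ ∃ x ∈ R, y = x ∨ y = x * iotaM l := by
  have hRD : R ≤ D := by
    rw [hR, hD]
    refine Subgroup.topologicalClosure_mono (Subgroup.map_mono fun g hg => ?_)
    obtain ⟨k, rfl⟩ := Subgroup.mem_zpowers_iff.mp hg
    rw [← range_embCu_inr]
    exact ⟨r 1 ^ k, by rw [map_zpow]; rfl⟩
  have hιD : iotaM l ∈ D := by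
    rw [hD]
    exact Subgroup.le_topologicalClosure _ ⟨iotaT l, by rw [← range_embCu_inr]; exact ⟨sr 0, rfl⟩, rfl⟩
  constructor
  · intro hy
    have hset : ((((heisD l).comap (PhiT l) ⊓ PiCdotT l).map (toHat l).toMonoidHom : Subgroup (PiC l)) : Set (PiC l)) ⊆
        (((Subgroup.zpowers (embCu l (1, r 1))).map (toHat l).toMonoidHom : Subgroup (PiC l)) : Set (PiC l)) ∪
          (Homeomorph.mulRight (iotaM l)) ''
            (((Subgroup.zpowers (embCu l (1, r 1))).map (toHat l).toMonoidHom : Subgroup (PiC l)) : Set (PiC l)) := by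
      rintro _ ⟨g, hg, rfl⟩
      rw [← range_embCu_inr] at hg
      obtain ⟨d, rfl⟩ := hg
      rcases d with i | i
      · left
        change toHat l (embCu l (1, r i)) ∈ _
        rw [(embCu_one_dihedral l i).1]
        exact (mem_map_zpowers_iff l).mpr ⟨_, rfl⟩
      · right
        refine ⟨toHat l (embCu l (1, r 1) ^ (-(show ℤ from i))), (mem_map_zpowers_iff l).mpr ⟨_, rfl⟩, ?_⟩
        change toHat l (embCu l (1, r 1) ^ (-(show ℤ from i))) * iotaM l = toHat l (embCu l (1, sr i))
        rw [(embCu_one_dihedral l i).2, iotaT_mul_t_zpow, map_mul, map_inv, zpow_neg, map_inv, iotaM]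
    have hy' : y ∈ closure ((((heisD l).comap (PhiT l) ⊓ PiCdotT l).map (toHat l).toMonoidHom : Subgroup (PiC l)) :
        Set (PiC l)) := by
      rw [← Subgroup.topologicalClosure_coe, ← hD]; exact hy
    have hy2 := closure_mono hset hy'
    rw [closure_union, ← Homeomorph.image_closure, ← Subgroup.topologicalClosure_coe, ← hR] at hy2
    rcases hy2 with h | ⟨x, hx, rfl⟩
    · exact ⟨y, h, Or.inl rfl⟩
    · exact ⟨x, hx, Or.inr rfl⟩
  · rintro ⟨x, hx, rfl | rfl⟩
    · exact hRD hx
    · exact D.mul_mem (hRD hx) hιD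

/-- **Description of `B := cl(η Π^tp_{Ċ̲})`** (`Π^tp_{Ċ̲} = {b = 0, e = 1} ≅ ℤ/l × D_∞`): `B = A ∪ A · η(ι)` with `A = cl(η Π^tp_{Ẋ̲})`.
(toy bookkeeping for [EtTh] Def. 2.5 (ii) / Rmk. 2.6.1; no claim about print) [cite: MochizukiEtTh2009, Def 2.5(ii) p.39] -/
theorem mem_closure_dotCu_iff {A : Subgroup (PiC l)}
    (hA : A = (((heisB0 l ⊓ heisPiX l).comap (PhiT l) ⊓ PiCdotT l).map (toHat l).toMonoidHom).topologicalClosure)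
    {B : Subgroup (PiC l)}
    (hB : B = (((heisB0 l).comap (PhiT l) ⊓ PiCdotT l).map (toHat l).toMonoidHom).topologicalClosure) (y : PiC l) :
    y ∈ B ↔ ∃ a ∈ A, y = a ∨ y = a * iotaM l := by
  have hAB : A ≤ B := by
    rw [hA, hB]
    exact Subgroup.topologicalClosure_mono (Subgroup.map_mono (inf_le_inf_right _ (Subgroup.comap_mono inf_le_left)))
  have hιB : iotaM l ∈ B := by
    rw [hB]
    exact Subgroup.le_topologicalClosure _ ⟨iotaT l, by rw [← range_embCu]; exact ⟨(1, sr 0), rfl⟩, rfl⟩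
  constructor
  · intro hy
    have hset : ((((heisB0 l).comap (PhiT l) ⊓ PiCdotT l).map (toHat l).toMonoidHom : Subgroup (PiC l)) : Set (PiC l)) ⊆
        ((((heisB0 l ⊓ heisPiX l).comap (PhiT l) ⊓ PiCdotT l).map (toHat l).toMonoidHom : Subgroup (PiC l)) : Set (PiC l)) ∪
          (Homeomorph.mulRight (iotaM l)) ''
            ((((heisB0 l ⊓ heisPiX l).comap (PhiT l) ⊓ PiCdotT l).map (toHat l).toMonoidHom : Subgroup (PiC l)) :
              Set (PiC l)) := by
      rintro _ ⟨g, hg, rfl⟩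
      rw [← range_embCu] at hg
      obtain ⟨⟨c, d⟩, rfl⟩ := hg
      rcases d with i | i
      · left
        exact ⟨_, (mem_dotXu_iff l _).mpr ⟨toAdd c, i, by rw [ofAdd_toAdd]⟩, rfl⟩
      · right
        refine ⟨toHat l (embCu l (c, 1) * embCu l (1, r 1) ^ (-(show ℤ from i))),
          ⟨_, (mem_dotXu_iff l _).mpr ⟨toAdd c, -i, ?_⟩, rfl⟩, ?_⟩
        · conv_rhs => rw [ofAdd_toAdd, embCu_eq_mul, (embCu_one_dihedral l (-i)).1]
          rfl
        · change toHat l (embCu l (c, 1) * embCu l (1, r 1) ^ (-(show ℤ from i))) * iotaM l = toHat l (embCu l (c, sr i))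
          rw [embCu_eq_mul l c (sr i), (embCu_one_dihedral l i).2, iotaT_mul_t_zpow, map_mul, map_mul, map_mul, map_inv,
            zpow_neg, map_inv, iotaM, mul_assoc]
    have hy' : y ∈ closure ((((heisB0 l).comap (PhiT l) ⊓ PiCdotT l).map (toHat l).toMonoidHom : Subgroup (PiC l)) :
        Set (PiC l)) := by
      rw [← Subgroup.topologicalClosure_coe, ← hB]; exact hy
    have hy2 := closure_mono hset hy'
    rw [closure_union, ← Homeomorph.image_closure, ← Subgroup.topologicalClosure_coe, ← hA] at hy2
    rcases hy2 with h | ⟨a, ha, rfl⟩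
    · exact ⟨y, h, Or.inl rfl⟩
    · exact ⟨a, ha, Or.inr rfl⟩
  · rintro ⟨a, ha, rfl | rfl⟩
    · exact hAB ha
    · exact B.mul_mem (hAB ha) hιB

/-- `η t ≠ 1`. (toy bookkeeping; no claim about print) [cite: MochizukiEtTh2009, §1 p.12] -/
theorem toHat_t_ne_one [NeZero l] : toHat l (embCu l (1, r 1)) ≠ 1 := by
  intro h
  have h2 := toHat_injective l (h.trans (map_one (toHat l)).symm)
  have h3 := congrArg (fun g : TG l => g.1.right) h2
  simp only [embCu_right] at h3
  exact one_ne_zero (r.inj (h3.trans one_def))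

/-- `η ι ≠ 1`. (toy bookkeeping; no claim about print) [cite: MochizukiEtTh2009, Prop 2.2 p.37] -/
theorem iotaM_ne_one [NeZero l] : iotaM l ≠ 1 := by
  intro h
  have h2 := toHat_injective l (h.trans (map_one (toHat l)).symm)
  have h3 := congrArg (fun g : TG l => g.1.right) h2
  change sr 0 = (1 : DihedralGroup 0) at h3
  rw [one_def] at h3
  cases h3

end Structure



end Literature.AnabelianGeometry.EtaleTheta.ThetaCovers.MonodromyModel

end
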